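import Literature.NumberTheory.DiophantineGeometry.GenEllDeCriticalValues
import Literature.NumberTheory.DiophantineGeometry.GenEllDeFibres
import HarnessLib

/-!
# `R_t ⊆ E_φ` and `x(R_t) ⊆ X_φ` on the cover `D_e : r^e = x(1−x)`; the archimedean lower bound for
# the ramification form under separation from `X_φ` ([GenEll] Thm. 2.1 (ii) ⇒ (i))

S. Mochizuki, *Arithmetic elliptic curves in general position*, Math. J. Okayama Univ. **52** (2010)
[cite: MochizukiGenEll2010, Thm 2.1 p.12], proof of Thm. 2.1 (ii) ⇒ (i), kurims pp. 12–13.  PROOF-ONLY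
bridge (abc-iut cell, route item `Summit.ABC.ABC.Theses.IUTThetaPilot.GenEllTwo`, number-field-only
plan GENELLTWO-P1ROUTE §3 (d)/§4) between

* `GenEllDeCriticalValues.lean` (`DeArch.critSet k` ⊇ the critical values of `t`, `DeArch.t`,
  `DeArch.tCrit`, the `x`-separation forms of the archimedean lower bound for `N`), and
* `GenEllDeFibres.lean` (`De.Ephi k B = t⁻¹(B)`, `De.Xphi k B = x(E_φ)` as `Finset`s).

For every finite `B ⊆ ℂ` CONTAINING `critSet k` (e.g. the cusp-fibre `β⁻¹{0,1,∞}` of a Belyi map `β`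
built on `A := critSet k`): every zero of the ramification form `N` on `D_e(ℂ)` lies in `E_φ`
(`mem_Ephi_of_N_eq_zero_of_subset`), its `x`-coordinate lies in `X_φ` (`fst_mem_Xphi_of_N_eq_zero`,
`critX_mem_Xphi`) — the printed "`R_t ⊆ E_φ`" —, hence separation of a point's `x`-coordinate from
`X_φ` (the hypothesis "all conjugates of `Q.x` `r`-far from `X_φ` at `∞`" of the menu spine) implies
separation from the zeros of `N` and therefore the archimedean lower bound of
`GenEllDeRamificationArch.lean` (`exists_pos_le_norm_N_of_Xphi_separated`,
`sum_posLog_le_of_Xphi_separated`).  Also `critSet_subset_toFinset_aroots`: the Belyi package's output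
clause `∀ a ∈ A, m(a) = 0` (with `m = p·q·(p−q)`) gives `critSet k ⊆ (roots of m)`.
Everything proved; no definitions; classical and undisputed; nothing here refers to the disputed parts
of the abc-iut corpus.
-/

noncomputable section

open Polynomial Real

namespace Literature.NumberTheory.DiophantineGeometry.GenEll

namespace DeArch

variable {k : ℕ}

/-! ### Zeros of `N` lie in `E_φ` once `B` contains their `t`-values -/

/-- A zero `P` of `N` on `D_e(F)` whose `t`-value lies in `B` is a point of `E_φ = t⁻¹(B)` (it is not a
pole of `t`). [cite: MochizukiGenEll2010, Thm 2.1 p.12] -/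
theorem mem_Ephi_of_N_eq_zero {F : Type*} [Field F] [CharZero F] {B : Finset F} {P : F × F}
    (hP : P ∈ curve F k) (hN : N k P.1 P.2 = 0) (hB : t k P.1 P.2 ∈ B) : P ∈ De.Ephi k B := by
  obtain ⟨hr, hs⟩ := snd_ne_zero_and_one_sub_two_mul_ne_zero hP hN
  exact De.mem_Ephi_iff_t.mpr ⟨mem_curve_iff.mp hP, hr, hs, hB⟩

/-- **`R_t ⊆ E_φ`** (over `ℂ`): if `B ⊇ critSet k` then every zero of `N` on `D_e(ℂ)` lies in
`E_φ = t⁻¹(B)`. [cite: MochizukiGenEll2010, Thm 2.1 p.12] -/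
theorem mem_Ephi_of_N_eq_zero_of_subset {B : Finset ℂ} (hB : critSet k ⊆ B) {P : ℂ × ℂ}
    (hP : P ∈ curve ℂ k) (hN : N k P.1 P.2 = 0) : P ∈ De.Ephi k B :=
  mem_Ephi_of_N_eq_zero hP hN (hB (t_mem_critSet_of_N_eq_zero hP hN))

/-- **`x(R_t) ⊆ X_φ`**: if `B ⊇ critSet k` then the `x`-coordinate of every zero of `N` on `D_e(ℂ)`
lies in `X_φ`. [cite: MochizukiGenEll2010, Thm 2.1 p.12] -/
theorem fst_mem_Xphi_of_N_eq_zero {B : Finset ℂ} (hB : critSet k ⊆ B) {P : ℂ × ℂ}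
    (hP : P ∈ curve ℂ k) (hN : N k P.1 P.2 = 0) : P.1 ∈ De.Xphi k B :=
  De.mem_Xphi.mpr ⟨P.2, mem_Ephi_of_N_eq_zero_of_subset hB hP hN⟩

/-- The critical abscissae lie in `X_φ`: `critX θ ∈ X_φ` for every complex root `θ` of `R`, whenever
`B ⊇ critSet k`. [cite: MochizukiGenEll2010, Thm 2.1 p.12] -/
theorem critX_mem_Xphi {B : Finset ℂ} (hB : critSet k ⊆ B) {θ : ℂ}
    (hθ : aeval θ (DeCrit.Rpoly k) = 0) : DeCrit.critX k θ ∈ De.Xphi k B := by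
  have hmem : (DeCrit.critPoint k θ : ℂ × ℂ) ∈ curve ℂ k :=
    mem_curve_iff.mpr (DeCrit.critPoint_mem k two_ne_zero (cast_two_mul_add_one_ne_zero k) hθ)
  have hN : N k (DeCrit.critPoint k θ).1 (DeCrit.critPoint k θ).2 = 0 := by
    rw [← Nval_eq_N]; exact DeCrit.Nval_critPoint k two_ne_zero (cast_two_mul_add_one_ne_zero k) hθ
  exact fst_mem_Xphi_of_N_eq_zero hB hmem hN

/-- The Belyi package's output clause gives the inclusion `critSet ⊆ B`: if `m ∈ ℚ[X]` is nonzero and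
vanishes on `critSet k`, then `critSet k ⊆` the finite set of complex roots of `m`.
[cite: MochizukiGenEll2010, Thm 2.1 p.12] -/
theorem critSet_subset_toFinset_aroots {m : ℚ[X]} (hm0 : m ≠ 0)
    (hm : ∀ a ∈ critSet k, aeval a m = 0) : critSet k ⊆ (m.aroots ℂ).toFinset := fun a ha =>
  Multiset.mem_toFinset.mpr
    (mem_aroots'.mpr ⟨(Polynomial.map_ne_zero_iff (algebraMap ℚ ℂ).injective).mpr hm0, hm a ha⟩)

/-! ### Separation from `X_φ` ⇒ the archimedean lower bound for `N` -/

/-- Separation of the `x`-coordinate from `X_φ` (with `B ⊇ critSet k`) implies sup-distance separation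
from every zero of `N` on `D_e(ℂ)`. [cite: MochizukiGenEll2010, Thm 2.1 p.12] -/
theorem separated_of_Xphi_separated {B : Finset ℂ} (hB : critSet k ⊆ B) {ρ : ℝ} {P : ℂ × ℂ}
    (hsep : ∀ a ∈ De.Xphi k B, ρ ≤ ‖P.1 - a‖) :
    ∀ Q ∈ curve ℂ k, N k Q.1 Q.2 = 0 → ρ ≤ dist P Q :=
  separated_of_x_separated fun _ hθ => hsep _ (critX_mem_Xphi hB hθ)

/-- LOWER BOUND UNDER SEPARATION FROM `X_φ`: for every `ρ > 0` there is `c > 0` (depending only on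
`e`, `ρ`: the constant of `exists_pos_le_norm_N_of_separated`) such that for every finite `B ⊇ critSet k`
and every `P ∈ D_e(ℂ)` whose `x`-coordinate is `ρ`-far from `X_φ = x(t⁻¹B)`, `‖N(P)‖ ≥ c`.
[cite: MochizukiGenEll2010, Thm 2.1 p.12] -/
theorem exists_pos_le_norm_N_of_Xphi_separated (k : ℕ) {ρ : ℝ} (hρ : 0 < ρ) :
    ∃ c : ℝ, 0 < c ∧ ∀ B : Finset ℂ, critSet k ⊆ B → ∀ P ∈ curve ℂ k,
      (∀ a ∈ De.Xphi k B, ρ ≤ ‖P.1 - a‖) → c ≤ ‖N k P.1 P.2‖ := by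
  obtain ⟨c, hc, h⟩ := exists_pos_le_norm_N_of_separated k hρ
  exact ⟨c, hc, fun B hB P hP hsep => h P hP (separated_of_Xphi_separated hB hsep)⟩

/-- NUMBER-FIELD FORM UNDER SEPARATION OF THE CONJUGATES FROM `X_φ` — the shape "all conjugates of
`Q.x` `r`-far from `X_φ` at `∞`" of the menu spine: with the constant `c` of
`exists_pos_le_norm_N_of_separated` and any finite `B ⊇ critSet k`,
`Σ_{σ : K →+* ℂ} log⁺ ‖σ(N(x,r))‖⁻¹ ≤ [K:ℚ]·log⁺ c⁻¹`. [cite: MochizukiGenEll2010, Thm 2.1 p.12] -/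
theorem sum_posLog_le_of_Xphi_separated {K : Type*} [Field K] [NumberField K] {x r : K}
    (hxr : r ^ (2 * k + 1) = x * (1 - x)) {ρ c : ℝ} (hc : 0 < c)
    (h : ∀ P ∈ curve ℂ k, (∀ Q ∈ curve ℂ k, N k Q.1 Q.2 = 0 → ρ ≤ dist P Q) →
      c ≤ ‖N k P.1 P.2‖)
    {B : Finset ℂ} (hB : critSet k ⊆ B)
    (hsep : ∀ σ : K →+* ℂ, ∀ a ∈ De.Xphi k B, ρ ≤ ‖σ x - a‖) :
    ∑ σ : K →+* ℂ, log⁺ ‖σ (N k x r)‖⁻¹ ≤ Module.finrank ℚ K * log⁺ c⁻¹ :=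
  sum_posLog_le hxr hc h fun σ => separated_of_Xphi_separated hB (P := (σ x, σ r)) (hsep σ)

/-- Per-embedding form: `c ≤ ‖σ(N(x, r))‖` for each `σ : K →+* ℂ` whose conjugate `σ x` is `ρ`-far from
`X_φ` (`B ⊇ critSet k`) — the archimedean separation hypothesis `δ ≤ ‖σ a‖` of the place-wise
summation (`FibreConductor.inv_finrank_mul_sum_logNorm_le`) at `a := N(x, r)`, `δ := c`.
[cite: MochizukiGenEll2010, Thm 2.1 p.12] -/
theorem le_norm_embedding_N_of_Xphi_separated {K : Type*} [Field K] {x r : K}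
    (hxr : r ^ (2 * k + 1) = x * (1 - x)) {ρ c : ℝ}
    (h : ∀ P ∈ curve ℂ k, (∀ Q ∈ curve ℂ k, N k Q.1 Q.2 = 0 → ρ ≤ dist P Q) →
      c ≤ ‖N k P.1 P.2‖)
    {B : Finset ℂ} (hB : critSet k ⊆ B) (σ : K →+* ℂ)
    (hsep : ∀ a ∈ De.Xphi k B, ρ ≤ ‖σ x - a‖) : c ≤ ‖σ (N k x r)‖ :=
  le_norm_embedding_N hxr h σ (separated_of_Xphi_separated hB (P := (σ x, σ r)) hsep)

end DeArch

end Literature.NumberTheory.DiophantineGeometry.GenEll
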